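import Summits.ABC.IUTFork.Joshi.ArchimedeanOstrowski
import Summits.ABC.IUTFork.Joshi.ArchimedeanOstrowskiLiteral

/-!
# [J-II½] Prop. 2.3.1 («Ostrowski's Theorem») DISCHARGED in kernel in the reading of the theorem it names:
# `prop231_holds : ATS2half.Prop231` — every archimedean valuation on `ℂ` in Bourbaki's sense is `‖ι(·)‖^s`

Proof-only companion file of the abc-iut cell, branch E «type Joshi's construction, test vs S» (rung LADDER-ABC:A2.E;
seat abc-iut-E-t38, gen 4 — the slot T-38 lineage that typed the item). SOURCE: K. Joshi, *Construction of Arithmetic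
Teichmüller Spaces II½: Deformations of Number Fields*, arXiv:2305.10398**v12** (UNREFEREED; bib `Joshi2023ATS2half`),
Prop. 2.3.1, p.12 l.7–10 of the render `HOME/plan/repair/lit/renders/Joshi-arxiv-2305.10398-ATS2half/`:
«Proposition 2.3.1 (Ostrowski's Theorem). Any archimedean valuation on `ℂ` (in the above sense) is of the form `|−|^s_ℂ`
for `0 < s ∈ ℝ`.» Here «in the above sense» = valued fields «in the sense of [Bourbaki]» (§2.3 p.11 l.33–45): `|x| = 0 ↔
x = 0`, multiplicative, WEAK triangle inequality `|x + y| ≤ A·max(|x|,|y|)`, non-trivial — slot T-37's `ATS2h.IsValuedField`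
— and «archimedean» = not non-archimedean (p.12 l.1–3), slot T-38's `ATS2half.IsArchimedeanAbs`.

STATE OF THE ITEM BEFORE THIS FILE (registry row J2h:Prop2.3.1): typed twice in `Joshi/ArchimedeanUntiltsJoshi.lean`
(p432383) — LITERALLY (`ATS2half.Prop231Literal`: the valuation IS `‖·‖^s`), REFUTED in kernel by E-t60
(`ATS2half.not_prop231Literal`, p433575: `‖σ(·)‖` for a wild automorphism `σ` of `ℂ`), and in the reading of the classical
theorem the sentence names (`ATS2half.Prop231`: `abs = ‖ι(·)‖^s` for a field embedding `ι : ℂ →+* ℂ`), left as a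
claim-tagged HYPOTHESIS («NONE in Mathlib for ℂ»). THIS FILE closes the second reading:

* `absoluteValue_of_isArchimedeanAbs` — a Bourbaki archimedean valuation `abs` on ANY field has a power `abs^e`
  (`e > 0`) which is a genuine, not non-archimedean `AbsoluteValue` (weak constant `A` ↦ `A^e ≤ 2`, then Artin's lemma
  `ArchimedeanOstrowski.add_le_add_of_weak_two`);
* `prop231_holds : ATS2half.Prop231` — by Ostrowski's theorem for archimedean absolute values, proved in kernel in
  `Joshi/ArchimedeanOstrowski.lean` (`ArchimedeanOstrowski.exists_ringHom_complex_rpow_eq`, via Mathlib's Ostrowski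
  theorem on `ℚ` and Gelfand–Mazur theorem over `ℝ`);
* `isArchimedeanAbs_iff` — the CHARACTERISATION: `IsArchimedeanAbs abs ↔ ∃ s > 0, ∃ ι : ℂ →+* ℂ, abs = ‖ι(·)‖^s`;
* `prop231_adjudication : ¬ Prop231Literal ∧ Prop231` — the printed sentence fully adjudicated in kernel: false as
  printed (E-t60), true as the theorem it cites ([Artin 2006, Ch. 1], Ostrowski 1916).

FRAMING. This discharges a STANDARD-MATHEMATICS hypothesis of the typed [J-II½] §2.3; Joshi's construction uses Prop. 2.3.1
only through Def. 2.3.2 / Prop. 2.4.3 (exponents `s`), untouched. It is NOT a verdict on Joshi's construction or on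
[IUTchIII] Cor. 3.12; **no side is taken** on any author (Mochizuki / Scholze–Stix / Joshi / Dupuy–Hilado); typed ≠ proved;
no new claim, no `def`, no hypothesis `Prop`, nothing of the cell's frozen interface imported (E-PLAN R14). Standard axioms
only; sorry-free. bears_on: LADDER-ABC:A2.E
-/

set_option autoImplicit false

noncomputable section

namespace Summit.ABC.IUTFork.Joshi.ATS2half

open Summit.ABC.IUTFork.Joshi.ATS2h (IsValuedField)
open Summit.ABC.IUTFork.Joshi.ArchimedeanOstrowski

universe u

/-! ## 1. From a Bourbaki archimedean valuation to a (Mathlib) absolute value -/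

section Bourbaki

variable {K : Type u} [Field K]

/-- `(max a b)^e ≤ max (a^e) (b^e)` (the power of the larger argument is one of the two). [folklore] -/
theorem max_rpow_le_max_rpow (a b e : ℝ) : (max a b) ^ e ≤ max (a ^ e) (b ^ e) := by
  rcases le_total a b with h | h
  · rw [max_eq_right h]; exact le_max_right _ _
  · rw [max_eq_left h]; exact le_max_left _ _

/-- **A Bourbaki valuation has a power which is an absolute value.** If `abs : K → ℝ` is a valued-field structure in
Bourbaki's sense (slot T-37's `ATS2h.IsValuedField`: weak triangle inequality with some constant `A`) that is not
non-archimedean, then for some `e > 0` the power `abs^e` is an `AbsoluteValue K ℝ` (triangle inequality!) which is not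
non-archimedean: choose `e` with `A^e ≤ 2` and apply Artin's lemma. [folklore] -/
theorem absoluteValue_of_isArchimedeanAbs {abs : K → ℝ} (habs : IsArchimedeanAbs abs) :
    ∃ (e : ℝ) (v : AbsoluteValue K ℝ), 0 < e ∧ (∀ x, v x = abs x ^ e) ∧ ¬ IsNonarchimedean v := by
  obtain ⟨hV, hna⟩ := habs
  obtain ⟨A, hA, hweak⟩ := hV.exists_const
  -- an exponent `e > 0` with `A ^ e ≤ 2`
  obtain ⟨e, he, hAe⟩ : ∃ e : ℝ, 0 < e ∧ A ^ e ≤ 2 := by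
    rcases le_or_gt A 2 with h | h
    · exact ⟨1, one_pos, by rwa [Real.rpow_one]⟩
    · refine ⟨Real.logb A 2, Real.logb_pos (lt_trans one_lt_two h) one_lt_two, ?_⟩
      rw [Real.rpow_logb hA (ne_of_gt (lt_trans one_lt_two h)) two_pos]
  have h0 : ∀ x, 0 ≤ abs x := hV.nonneg
  have h1 : abs 1 = 1 := by
    have h := hV.map_mul 1 1
    rw [one_mul] at h
    have hne : abs 1 ≠ 0 := fun h0' => one_ne_zero ((hV.eq_zero_iff 1).mp h0')
    -- `abs 1 = abs 1 * abs 1`, `abs 1 ≠ 0` ⟹ `abs 1 = 1`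
    have := mul_left_cancel₀ hne (h.symm.trans (mul_one (abs 1)).symm)
    exact this
  -- the power `abs ^ e` as a monoid-with-zero hom
  let f : K →*₀ ℝ :=
    { toFun := fun x => abs x ^ e
      map_zero' := by
        show abs 0 ^ e = 0
        rw [(hV.eq_zero_iff 0).mpr rfl, Real.zero_rpow he.ne']
      map_one' := by
        show abs 1 ^ e = 1
        rw [h1, Real.one_rpow]
      map_mul' := fun a b => by
        show abs (a * b) ^ e = abs a ^ e * abs b ^ e
        rw [hV.map_mul, Real.mul_rpow (h0 a) (h0 b)] }
  have hf : ∀ x, f x = abs x ^ e := fun _ => rfl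
  have hf0 : ∀ x, 0 ≤ f x := fun x => Real.rpow_nonneg (h0 x) e
  -- weak triangle inequality with constant `2`
  have h2 : ∀ x y, f (x + y) ≤ 2 * max (f x) (f y) := by
    intro x y
    rw [hf, hf, hf]
    have hm : 0 ≤ max (abs x) (abs y) := le_max_of_le_left (h0 x)
    calc abs (x + y) ^ e ≤ (A * max (abs x) (abs y)) ^ e :=
          Real.rpow_le_rpow (h0 _) (hweak x y) he.le
      _ = A ^ e * (max (abs x) (abs y)) ^ e := Real.mul_rpow hA.le hm
      _ ≤ 2 * max (abs x ^ e) (abs y ^ e) :=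
          mul_le_mul hAe (max_rpow_le_max_rpow _ _ _) (Real.rpow_nonneg hm e) zero_le_two
  -- Artin's lemma: the triangle inequality
  have htri : ∀ x y, f (x + y) ≤ f x + f y := add_le_add_of_weak_two f hf0 h2
  let v : AbsoluteValue K ℝ :=
    { toFun := fun x => abs x ^ e
      map_mul' := fun a b => by
        show abs (a * b) ^ e = abs a ^ e * abs b ^ e
        rw [hV.map_mul, Real.mul_rpow (h0 a) (h0 b)]
      nonneg' := fun x => Real.rpow_nonneg (h0 x) e
      eq_zero' := fun x => by
        show abs x ^ e = 0 ↔ x = 0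
        rw [Real.rpow_eq_zero_iff_of_nonneg (h0 x), hV.eq_zero_iff]
        simp [he.ne']
      add_le' := fun a b => htri a b }
  have hv : ∀ x, v x = abs x ^ e := fun _ => rfl
  refine ⟨e, v, he, hv, fun hnon => hna fun x y => ?_⟩
  -- if `abs^e` were non-archimedean, so would be `abs = (abs^e)^{1/e}`
  have hxy : v (x + y) ≤ max (v x) (v y) := hnon x y
  rw [hv, hv, hv] at hxy
  calc abs (x + y) = (abs (x + y) ^ e) ^ e⁻¹ := (Real.rpow_rpow_inv (h0 _) he.ne').symm
    _ ≤ (max (abs x ^ e) (abs y ^ e)) ^ e⁻¹ :=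
        Real.rpow_le_rpow (Real.rpow_nonneg (h0 _) e) hxy (inv_nonneg.mpr he.le)
    _ ≤ max ((abs x ^ e) ^ e⁻¹) ((abs y ^ e) ^ e⁻¹) := max_rpow_le_max_rpow _ _ _
    _ = max (abs x) (abs y) := by rw [Real.rpow_rpow_inv (h0 _) he.ne', Real.rpow_rpow_inv (h0 _) he.ne']

/-- **Ostrowski for Bourbaki valuations, any field.** An archimedean valued-field structure `abs` on a field `K` in
Bourbaki's sense is `‖ι(·)‖^s` for a field embedding `ι : K →+* ℂ` and some `s > 0` (no upper bound on `s` here: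
`‖·‖²` on `ℂ` is a Bourbaki valuation with `A = 4`). [folklore] -/
theorem exists_ringHom_complex_of_isArchimedeanAbs {abs : K → ℝ} (habs : IsArchimedeanAbs abs) :
    ∃ (ι : K →+* ℂ) (s : ℝ), 0 < s ∧ ∀ x, abs x = ‖ι x‖ ^ s := by
  obtain ⟨e, v, he, hv, hna⟩ := absoluteValue_of_isArchimedeanAbs habs
  obtain ⟨ι, s, hs, -, hvs⟩ := exists_ringHom_complex_rpow_eq v hna
  refine ⟨ι, s * e⁻¹, mul_pos hs (inv_pos.mpr he), fun x => ?_⟩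
  have h := hvs x
  rw [hv] at h
  calc abs x = (abs x ^ e) ^ e⁻¹ := (Real.rpow_rpow_inv (habs.1.nonneg x) he.ne').symm
    _ = (‖ι x‖ ^ s) ^ e⁻¹ := by rw [h]
    _ = ‖ι x‖ ^ (s * e⁻¹) := (Real.rpow_mul (norm_nonneg _) s e⁻¹).symm

/-- Conversely (elementary), `‖ι(·)‖^s` is an archimedean Bourbaki valuation for every field embedding `ι : K →+* ℂ`
and `s > 0` (weak constant `A = 2^s`, non-trivial at `2`; slot T-38's `isValuedField_powAbs` is the case `ι = id`,
E-t60's `isArchimedeanAbs_norm_ringEquiv` the case of an automorphism and `s = 1`). [folklore] -/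
theorem isArchimedeanAbs_norm_comp_rpow [CharZero K] (ι : K →+* ℂ) {s : ℝ} (hs : 0 < s) :
    IsArchimedeanAbs (fun x : K => ‖ι x‖ ^ s) := by
  refine ⟨?_, not_isNonarchimedean_norm_comp_rpow ι hs⟩
  have hp : IsValuedField (powAbs s) := isValuedField_powAbs hs
  refine ⟨fun x => Real.rpow_nonneg (norm_nonneg _) s, fun x => ?_, fun x y => ?_, ?_, ?_⟩
  · rw [Real.rpow_eq_zero_iff_of_nonneg (norm_nonneg _), norm_eq_zero, map_eq_zero_iff ι ι.injective]
    simp [hs.ne']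
  · show ‖ι (x * y)‖ ^ s = ‖ι x‖ ^ s * ‖ι y‖ ^ s
    rw [map_mul, norm_mul, Real.mul_rpow (norm_nonneg _) (norm_nonneg _)]
  · obtain ⟨A, hA, hweak⟩ := hp.exists_const
    refine ⟨A, hA, fun x y => ?_⟩
    show ‖ι (x + y)‖ ^ s ≤ A * max (‖ι x‖ ^ s) (‖ι y‖ ^ s)
    rw [map_add]
    exact hweak (ι x) (ι y)
  · refine ⟨2, two_ne_zero, ?_⟩
    show ‖ι 2‖ ^ s ≠ 1
    rw [map_ofNat, Complex.norm_ofNat]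
    exact ne_of_gt (Real.one_lt_rpow one_lt_two hs)

end Bourbaki

/-! ## 2. `ATS2half.Prop231` holds; the characterisation; the adjudication of the printed sentence -/

/-- **[J-II½] Prop. 2.3.1 in the reading of the theorem it names — PROVED.** Every archimedean valuation on `ℂ` in
Bourbaki's sense is `|ι(−)|^s_ℂ` for some `s > 0` and some field embedding `ι : ℂ →+* ℂ` (Ostrowski 1916; [Artin 2006,
Ch. 1 Thm. 10], the reference Joshi cites p.12 l.1). Discharges the claim-tagged hypothesis `ATS2half.Prop231` of
`Joshi/ArchimedeanUntiltsJoshi.lean` (p432383). [claim: Joshi2023ATS2half, status: disputed] -/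
theorem prop231_holds : Summit.ABC.IUTFork.Joshi.ATS2half.Prop231 := by
  intro abs habs
  obtain ⟨ι, s, hs, h⟩ := exists_ringHom_complex_of_isArchimedeanAbs habs
  exact ⟨s, hs, ι, funext fun x => by rw [Function.comp_apply, powAbs_apply, h x]⟩

/-- **Characterisation of the archimedean valuations on `ℂ` in Bourbaki's sense**: exactly the functions `‖ι(·)‖^s`,
`ι : ℂ →+* ℂ` a field embedding, `s > 0`. [folklore] -/
theorem isArchimedeanAbs_iff (abs : ℂ → ℝ) :
    IsArchimedeanAbs abs ↔ ∃ s : ℝ, 0 < s ∧ ∃ ι : ℂ →+* ℂ, abs = powAbs s ∘ ι := by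
  refine ⟨prop231_holds abs, ?_⟩
  rintro ⟨s, hs, ι, rfl⟩
  exact isArchimedeanAbs_norm_comp_rpow ι hs

/-- **The printed sentence adjudicated in kernel on both readings** (a faithfulness datum for the referee lane, no
verdict on Joshi's construction, which uses Prop. 2.3.1 only through exponents): read literally («is of the form
|−|^s_ℂ») it is FALSE (`ATS2half.not_prop231Literal`, E-t60 p433575 — wild automorphisms of `ℂ`); read as the theorem it
cites (up to a field embedding) it is TRUE (`prop231_holds`). [claim: Joshi2023ATS2half, status: disputed] -/
theorem prop231_adjudication :
    ¬ Summit.ABC.IUTFork.Joshi.ATS2half.Prop231Literal ∧ Summit.ABC.IUTFork.Joshi.ATS2half.Prop231 :=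
  ⟨Summit.ABC.IUTFork.Joshi.ATS2half.not_prop231Literal, prop231_holds⟩

end Summit.ABC.IUTFork.Joshi.ATS2half
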